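import Mathlib.Combinatorics.SetFamily.Compression.Down
import Mathlib.Tactic
import HarnessLib
import HarnessLib.Audit.Tags
import Summits.CriticalPhenomena.PercolationContinuityZ3.Theorems.PercNearOneGluingNoHeavyLowerTailSahiRainbowStrictCore

/-!
# The strict rainbow lemma, VI: the TWIN-COUNT form of the open step

Support file (seat `prim-masterthm-p1`, gen 40; `--supports stmt-CriticalPhenomena-4575`).  One typed statement (`TwinCountCore`) and unconditional
theorems; no `sorry`, standard axioms.  Memo `run/shared/lean/prim/prim-masterthm/FROM-prim-masterthm-p1-g40-STRICT-RAINBOW.md` §7.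

SETTING (`…SahiRainbowStrictDefs/…/Core`): `𝒜 ⊆ 2^F` complement-free, `z ∈ F`, `𝔅 = 𝒜.memberSubfamily z ∪ 𝒜.nonMemberSubfamily z`,
`𝔄 = 𝒜.memberSubfamily z ∩ 𝒜.nonMemberSubfamily z` (the `k_z = #𝔄` doubled members), `L = rainbowMeets F 𝒜`, and the TWINS at `z`:
`L.memberSubfamily z ∩ L.nonMemberSubfamily z` (`z`-free colours `W` with `insert z W` also a colour).  For `y ∈ F.erase z` the family
`pinnedEndpoints 𝒜 z y` = members `b` of `𝔅` whose complement `(F.erase z) \ b` is also in `𝔅` and which contain `y` picks ONE endpoint of every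
complementary pair of `𝔅`, so its size is the number `m_z` of near-complementary pairs of `𝒜` at `z` (independently of `y`).

NEW HERE ([this work], gen 40).
* `card_le_card_rainbowMeets_of_twinCount` — **the twin-count step**: if `RainbowStrictOn (F.erase z)` and the twins at `z` number at least
  `k_z + m_z` (`#𝔄 + #pinnedEndpoints 𝒜 z y ≤ #twins`), then `#𝒜 ≤ #rainbowMeets F 𝒜` — no extra colours are needed, whatever the types of the pairs
  and the doubled members.  (Master count with `E` = all twins; the other endpoints form a complement-free family repaid by the weak hypothesis.)
* `TwinCountCore` (typed, [status: open]): every family of the CORE residual (`PinnedResidualCore` hypotheses) has a point `z` and `y ∈ F.erase z`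
  with `#𝔄 + #pinnedEndpoints 𝒜 z y ≤ #twins at z`.  CENSUS (`prim-masterthm-p1/code-g40/c/twcount.c`, `tc.c`): on the 16 core families of `2^4`
  EQUALITY holds at EVERY point; on the 3 522 core families of `2^5` the inequality holds at EVERY point with margin ≥ 1; over ALL complement-free
  families of `2^≤5` and all points, `#twins ≥ k_z + m_z − 1` (the deficit `−1` occurs only for `N ≤ 6`, at points carrying two pairs of mixed type or
  one pair and one doubled member).
* `rainbowStrict_of_twinCountCore`, `rainbowMeetCojoin_of_twinCountCore`: **the rainbow lemma follows from the twin-count inequality on the core.**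
HONEST FRAMING: `TwinCountCore`, `RainbowStrict`, `RainbowMeetCojoin` remain OPEN; the theorems are unconditional reductions. [this work]
-/

namespace Summit.CriticalPhenomena.PercolationContinuityZ3.Theorems.SahiColouredDaykin

open Finset

variable {α : Type*} [DecidableEq α]

/-- One endpoint of every complementary pair of the projected family at `z`: the members `b` of `𝔅` with `(F.erase z) \ b ∈ 𝔅` and `y ∈ b`.
[this work] -/
def pinnedEndpoints (F : Finset α) (𝒜 : Finset (Finset α)) (z y : α) : Finset (Finset α) :=
  (𝒜.memberSubfamily z ∪ 𝒜.nonMemberSubfamily z).filter fun b =>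
    (F.erase z) \ b ∈ 𝒜.memberSubfamily z ∪ 𝒜.nonMemberSubfamily z ∧ y ∈ b

section Twin

variable {F : Finset α} {𝒜 : Finset (Finset α)} {z y : α}

/-- **The twin-count step.**  If the strengthened rainbow statement holds inside `F.erase z`, `y ∈ F.erase z`, and the twins at `z` number at least
`#𝔄 + #pinnedEndpoints 𝒜 z y` (doubled members plus near-complementary pairs at `z`), then `#𝒜 ≤ #rainbowMeets F 𝒜`. [this work] -/
theorem card_le_card_rainbowMeets_of_twinCount (h𝒜F : ∀ a ∈ 𝒜, a ⊆ F) (hy : y ∈ F.erase z)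
    (IH : RainbowStrictOn (F.erase z))
    (htw : #(𝒜.memberSubfamily z ∩ 𝒜.nonMemberSubfamily z) + #(pinnedEndpoints F 𝒜 z y) ≤
      #((rainbowMeets F 𝒜).memberSubfamily z ∩ (rainbowMeets F 𝒜).nonMemberSubfamily z)) :
    #𝒜 ≤ #(rainbowMeets F 𝒜) := by
  set M := 𝒜.memberSubfamily z with hM
  set N := 𝒜.nonMemberSubfamily z with hN
  set L := rainbowMeets F 𝒜 with hL
  have hsum : #(M ∪ N) + #(M ∩ N) = #𝒜 := card_compress_add_card_doubled 𝒜 z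
  have h𝔅F : ∀ b ∈ M ∪ N, b ⊆ F.erase z := fun b hb => subset_erase_of_mem_compress h𝒜F hb
  have hcc : ∀ {b : Finset α}, b ⊆ F.erase z → (F.erase z) \ ((F.erase z) \ b) = b := fun hb => Finset.sdiff_sdiff_eq_self hb
  set U := (M ∪ N).filter (fun b => (F.erase z) \ b ∈ M ∪ N ∧ y ∈ b) with hU
  set B := (M ∪ N).filter (fun b => ¬ ((F.erase z) \ b ∈ M ∪ N ∧ y ∈ b)) with hB
  have hUeq : pinnedEndpoints F 𝒜 z y = U := rfl
  have hUB : #U + #B = #(M ∪ N) := by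
    rw [hU, hB]; exact card_filter_add_card_filter_not _
  have hBF : ∀ b ∈ B, b ⊆ F.erase z := fun b hb => h𝔅F b (mem_filter.1 hb).1
  have hBcf : ∀ b ∈ B, (F.erase z) \ b ∉ B := by
    intro b hb hb'
    obtain ⟨hb1, hb2⟩ := mem_filter.1 hb
    obtain ⟨hb1', hb2'⟩ := mem_filter.1 hb'
    have hyb : y ∉ b := fun h => hb2 ⟨hb1', h⟩
    have hyb' : y ∉ (F.erase z) \ b := fun h => hb2' ⟨by rw [hcc (h𝔅F b hb1)]; exact hb1, h⟩
    exact hyb' (mem_sdiff.2 ⟨hy, hyb⟩)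
  have IHB := (IH B hBF hBcf).1
  have hBsub : B ⊆ M ∪ N := filter_subset _ _
  have cB := card_le_card (rainbowMeets_mono (F.erase z) hBsub)
  have c1 := card_compress_add_card_twins_le F 𝒜 z (L.memberSubfamily z ∩ L.nonMemberSubfamily z) (fun _ h => h)
  rw [← hM, ← hN, ← hL] at c1
  rw [hUeq] at htw
  omega

end Twin

/-- **The twin-count inequality on the core (typed).**  Every family of the core residual (hypotheses of `PinnedResidualCore`) has a point `z`
and a point `y ≠ z` with `#𝔄 + #pinnedEndpoints 𝒜 z y ≤ #(twins at z)`.  Census: holds at EVERY point of every core family of `2^4` (with equality)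
and `2^5` (margin ≥ 1). [this work] [status: open] -/
@[conjecture] def TwinCountCore (α : Type*) [DecidableEq α] : Prop :=
  ∀ (F : Finset α) (𝒜 : Finset (Finset α)), (∀ a ∈ 𝒜, a ⊆ F) → (∀ a ∈ 𝒜, F \ a ∉ 𝒜) → RainbowDegenerate F 𝒜 →
    (∀ r ∈ F, ¬ ∀ b ∈ 𝒜.memberSubfamily r ∪ 𝒜.nonMemberSubfamily r,
      (F.erase r) \ b ∉ 𝒜.memberSubfamily r ∪ 𝒜.nonMemberSubfamily r) →
    (∀ r ∈ F, 𝒜.memberSubfamily r ∩ 𝒜.nonMemberSubfamily r = ∅ →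
      ¬ ((∀ b ∈ 𝒜.memberSubfamily r ∪ 𝒜.nonMemberSubfamily r, (F.erase r) \ b ∈ 𝒜.memberSubfamily r ∪ 𝒜.nonMemberSubfamily r →
            b ∈ 𝒜.nonMemberSubfamily r ∧ (F.erase r) \ b ∈ 𝒜.nonMemberSubfamily r) ∨
         (∀ b ∈ 𝒜.memberSubfamily r ∪ 𝒜.nonMemberSubfamily r, (F.erase r) \ b ∈ 𝒜.memberSubfamily r ∪ 𝒜.nonMemberSubfamily r →
            b ∈ 𝒜.memberSubfamily r ∧ (F.erase r) \ b ∈ 𝒜.memberSubfamily r))) →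
    (∀ p ∈ 𝒜, rainbowMeets F (𝒜.erase p) = rainbowMeets F 𝒜) →
    #F + 2 ≤ #𝒜 →
    ∃ z ∈ F, ∃ y ∈ F.erase z,
      #(𝒜.memberSubfamily z ∩ 𝒜.nonMemberSubfamily z) + #(pinnedEndpoints F 𝒜 z y) ≤
        #((rainbowMeets F 𝒜).memberSubfamily z ∩ (rainbowMeets F 𝒜).nonMemberSubfamily z)

/-- The twin-count inequality on the core implies the core residual statement. [this work] -/
theorem pinnedResidualCore_of_twinCountCore (h : TwinCountCore α) : PinnedResidualCore α := by
  intro F 𝒜 h𝒜F hcf hdeg hpin hmix hfr hbig IH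
  obtain ⟨z, hz, y, hy, htw⟩ := h F 𝒜 h𝒜F hcf hdeg hpin hmix hfr hbig
  exact card_le_card_rainbowMeets_of_twinCount h𝒜F hy (IH z hz) htw

/-- **The strict rainbow lemma follows from the twin-count inequality on the core.** [this work] -/
theorem rainbowStrict_of_twinCountCore (h : TwinCountCore α) : RainbowStrict α :=
  rainbowStrict_of_pinnedResidualCore (pinnedResidualCore_of_twinCountCore h)

/-- **The rainbow lemma follows from the twin-count inequality on the core.** [this work] -/
theorem rainbowMeetCojoin_of_twinCountCore (h : TwinCountCore α) : RainbowMeetCojoin α :=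
  rainbowMeetCojoin_of_rainbowStrict (rainbowStrict_of_twinCountCore h)

end Summit.CriticalPhenomena.PercolationContinuityZ3.Theorems.SahiColouredDaykin
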